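import Summits.Ventures.CertifiedManyBodySolver.Downfold.IntervalCalculus
import Literature.MathematicalPhysics.QuantumLattice.HubbardNNNHoppingEnergyDensityRegionBounds
import HarnessLib

/-!
# Transport of certified `t ≡ 1` Hubbard-family energy bounds to a physical coupling box through
# SHAPE (`t'/t`, `U/t`) and SCALE (`t`)

Venture CertifiedManyBodySolver, cell `pub/hubbard-downfold` (stage S1 = downfolding front end;
consumers: stage S2 certified words over parameter boxes, `hubbard-downfold-unc-*`, `pub/hubbard-fast`),
seat hubbard-downfold-mod-1; namespace `Summit.Ventures.CertifiedManyBodySolver.Downfold`. Everything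
here is PROVED from tree facts (no definition, no named fact, no numerical input). HONEST FRAMING:
first certified bounds; not a superconductivity verdict; a downfolded box is a systematic modelling
claim and stays a hypothesis.

The certified side of the venture speaks about the DIMENSIONLESS family `H(1, t'/t, U/t)` at
`t ≡ 1`; the tree's positive homogeneity of the `t–t'` Hubbard ground-state energy density,
`e(t, t', U, n) = t · e(1, t'/t, U/t, n)` (`energyDensityTT'_eq_mul_unit`,
`HubbardNNNHoppingEnergyDensityRegionBounds` §6), says that splitting a physical box into SHAPE
(quotient intervals `NonemptyInterval.divPos`) and SCALE (the interval `T ∋ t`, `0 < T.fst`) loses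
nothing:

* `energyDensityTT'_mem_scale_mooreMul` — an enclosure `E ∋ e(1, s, u, n)` valid for all
  `s ∈ T'/T`, `u ∈ 𝒰/T` (`u ≥ 0`) gives `e(t, t', U, n) ∈ T · E` (Moore product) for all `t ∈ T`,
  `t' ∈ T'`, `U ∈ 𝒰`;
* `energyDensityTT'_ge_scale_min` / `energyDensityTT'_le_scale_max` — one-sided versions: a
  certified lower bound `L` (upper bound `R`) on the shape cell gives `min (T.fst L) (T.snd L) ≤ e`
  (`e ≤ max (T.fst R) (T.snd R)`) on the physical box — the sign of the bound decides which end of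
  the scale interval is extremal.

Box-level packaging (entries `t, t', U, n` of a `Downfold.Box`): `Downfold.OneBandBox`.
-/

namespace Summit.Ventures.CertifiedManyBodySolver.Downfold

open NonemptyInterval Literature.MathematicalPhysics.QuantumLattice
open Literature.MathematicalPhysics.QuantumLattice.ThermodynamicLimit

/-- If `L ≤ y` and `0 < x` with `x ∈ [c, d]` then `min (c L) (d L) ≤ x y` (sign split on `L`).
[folklore] -/
private theorem min_mul_le_mul_of_mem {c d x y L : ℝ} (hc : c ≤ x) (hd : x ≤ d) (hx : 0 < x)
    (hy : L ≤ y) : min (c * L) (d * L) ≤ x * y := by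
  have h1 : x * L ≤ x * y := mul_le_mul_of_nonneg_left hy hx.le
  rcases le_total 0 L with hL | hL
  · exact (min_le_left _ _).trans ((mul_le_mul_of_nonneg_right hc hL).trans h1)
  · exact (min_le_right _ _).trans ((mul_le_mul_of_nonpos_right hd hL).trans h1)

/-- If `y ≤ R` and `0 < x` with `x ∈ [c, d]` then `x y ≤ max (c R) (d R)`. [folklore] -/
private theorem mul_le_max_mul_of_mem {c d x y R : ℝ} (hc : c ≤ x) (hd : x ≤ d) (hx : 0 < x)
    (hy : y ≤ R) : x * y ≤ max (c * R) (d * R) := by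
  have h1 : x * y ≤ x * R := mul_le_mul_of_nonneg_left hy hx.le
  rcases le_total 0 R with hR | hR
  · exact h1.trans ((mul_le_mul_of_nonneg_right hd hR).trans (le_max_right _ _))
  · exact h1.trans ((mul_le_mul_of_nonpos_right hc hR).trans (le_max_left _ _))

/-- **Shape + scale transport of the ground-state energy density (two-sided).** Let a downfolded
box give the scale `t ∈ T` (`0 < T.fst`), `t' ∈ T'`, `U ∈ 𝒰` (`U ≥ 0`) and a filling `0 ≤ n < 2`,
and let `E` enclose the `t ≡ 1` energy density on the box's SHAPE cell: `e(1, s, u, n) ∈ E` for all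
`s ∈ T'/T`, `u ∈ 𝒰/T`, `u ≥ 0`. Then the physical energy density lies in the Moore product
`T · E`: `e(t, t', U, n) ∈ T · E`. Positive homogeneity `e(t,t',U,n) = t e(1,t'/t,U/t,n)`
(`energyDensityTT'_eq_mul_unit`) makes shape + scale lossless. [folklore] -/
theorem energyDensityTT'_mem_scale_mooreMul {T T' UU E : NonemptyInterval ℚ} (hT : 0 < T.fst)
    {t t' U n : ℝ} (ht : t ∈ T.ratCast ℝ) (ht' : t' ∈ T'.ratCast ℝ) (hU : U ∈ UU.ratCast ℝ)
    (hU0 : 0 ≤ U) (hn0 : 0 ≤ n) (hn2 : n < 2)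
    (hE : ∀ s u : ℝ, s ∈ (T'.divPos T hT).ratCast ℝ → u ∈ (UU.divPos T hT).ratCast ℝ → 0 ≤ u →
      energyDensityTT' 1 s u n ∈ E.ratCast ℝ) :
    energyDensityTT' t t' U n ∈ (T.mooreMul E).ratCast ℝ := by
  have hT0 : (0 : ℝ) < T.fst := by exact_mod_cast hT
  have ht0 : 0 < t := hT0.trans_le (mem_ratCast_iff.1 ht).1
  rw [energyDensityTT'_eq_mul_unit ht0 t' hU0 hn0 hn2, ratCast_mooreMul]
  exact mul_mem_mooreMul ht
    (hE _ _ (div_mem_divPos hT ht' ht) (div_mem_divPos hT hU ht) (div_nonneg hU0 ht0.le))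

/-- **Transport of a certified LOWER bound** through shape + scale: a lower bound `L ≤ e(1,s,u,n)`
valid on the shape cell gives `min (T.fst L) (T.snd L) ≤ e(t, t', U, n)` on the physical box.
[folklore] -/
theorem energyDensityTT'_ge_scale_min {T T' UU : NonemptyInterval ℚ} (hT : 0 < T.fst) {L : ℚ}
    {t t' U n : ℝ} (ht : t ∈ T.ratCast ℝ) (ht' : t' ∈ T'.ratCast ℝ) (hU : U ∈ UU.ratCast ℝ)
    (hU0 : 0 ≤ U) (hn0 : 0 ≤ n) (hn2 : n < 2)
    (hL : ∀ s u : ℝ, s ∈ (T'.divPos T hT).ratCast ℝ → u ∈ (UU.divPos T hT).ratCast ℝ → 0 ≤ u →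
      (L : ℝ) ≤ energyDensityTT' 1 s u n) :
    ((min (T.fst * L) (T.snd * L) : ℚ) : ℝ) ≤ energyDensityTT' t t' U n := by
  have hT0 : (0 : ℝ) < T.fst := by exact_mod_cast hT
  have htm := mem_ratCast_iff.1 ht
  have ht0 : 0 < t := hT0.trans_le htm.1
  rw [energyDensityTT'_eq_mul_unit ht0 t' hU0 hn0 hn2]
  push_cast
  exact min_mul_le_mul_of_mem htm.1 htm.2 ht0
    (hL _ _ (div_mem_divPos hT ht' ht) (div_mem_divPos hT hU ht) (div_nonneg hU0 ht0.le))

/-- **Transport of a certified UPPER bound** through shape + scale: an upper bound `e(1,s,u,n) ≤ R`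
valid on the shape cell gives `e(t, t', U, n) ≤ max (T.fst R) (T.snd R)` on the physical box.
[folklore] -/
theorem energyDensityTT'_le_scale_max {T T' UU : NonemptyInterval ℚ} (hT : 0 < T.fst) {R : ℚ}
    {t t' U n : ℝ} (ht : t ∈ T.ratCast ℝ) (ht' : t' ∈ T'.ratCast ℝ) (hU : U ∈ UU.ratCast ℝ)
    (hU0 : 0 ≤ U) (hn0 : 0 ≤ n) (hn2 : n < 2)
    (hR : ∀ s u : ℝ, s ∈ (T'.divPos T hT).ratCast ℝ → u ∈ (UU.divPos T hT).ratCast ℝ → 0 ≤ u →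
      energyDensityTT' 1 s u n ≤ (R : ℝ)) :
    energyDensityTT' t t' U n ≤ ((max (T.fst * R) (T.snd * R) : ℚ) : ℝ) := by
  have hT0 : (0 : ℝ) < T.fst := by exact_mod_cast hT
  have htm := mem_ratCast_iff.1 ht
  have ht0 : 0 < t := hT0.trans_le htm.1
  rw [energyDensityTT'_eq_mul_unit ht0 t' hU0 hn0 hn2]
  push_cast
  exact mul_le_max_mul_of_mem htm.1 htm.2 ht0
    (hR _ _ (div_mem_divPos hT ht' ht) (div_mem_divPos hT hU ht) (div_nonneg hU0 ht0.le))

end Summit.Ventures.CertifiedManyBodySolver.Downfold
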